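import Summits.HodgeConjecture.CorCM.CommonCoefficientCriterion
import HarnessLib

/-!
# The hypothesis-free additivity criterion for CM fields: `Hg(∏ A_i) = ∏ Hg(A_i)` iff the type vectors of the CM types
# satisfy no non-trivial common matrix-coefficient relation

COR-CM (cell `pub-hodgecm2`, binder seat `b16` gen 54, count-neutral claim STAB-CONJ, file F4b — the CM-field dress of F4a
`CorCM/CommonCoefficientCriterion`; theorems only, no definition, no named fact, no `sorry`).  NEW as stated, hence under
`Summits/`.  HONEST FRAMING: statements about families of CM types of arbitrary CM fields and products of CM abelian
varieties; `HC_CM` is neither used nor asserted — «HC / exceptional classes for NAMED classes».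

For CM fields `K_i` (`i ∈ I` finite), types `Φ_i`, type vectors `u_i = 𝟙_{Φ_i} − 𝟙_{Φ̄_i}` on `Hom(K_i, ℂ)` and
`g ∈ Aut(ℂ)` acting by composition, F4a says with NO hypothesis on the fields (Galois or not, shared subfields or not,
reducible odd modules or not):

* **`cmFamilyRank_add_card_eq_iff_forall_rel`** / **`isNondegenerateFamily_iff_forall_rel`** — `rank(Σ) + |I| =
  Σ_i rank Φ_i + 1` (`Hg(∏ A_i) = ∏ Hg(A_i)`) IFF every relation `Σ_i Σ_x μ_i(x) u_i(g ∘ x) = 0` (all `g`) splits slot by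
  slot; the family is nondegenerate IFF moreover every `Φ_i` is nondegenerate;
* two fields, `I = {i₀, i₁}`: **`cmFamilyRank_add_card_eq_iff_not_exists_commonCoeff`** /
  **`isNondegenerateFamily_iff_not_exists_commonCoeff`** — additive IFF NO `μ : Hom(K_{i₀}, ℂ) → ℚ`,
  `λ : Hom(K_{i₁}, ℂ) → ℚ` have `Σ_x μ(x) u₀(g ∘ x) = Σ_y λ(y) u₁(g ∘ y)` for all `g ∈ Aut(ℂ)` with some value non-zero
  («no common non-zero matrix coefficient»); `not_isNondegenerateFamily_of_commonCoeff`;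
* abelian varieties: `hodgeConjectureFor_prod_of_not_exists_commonCoeff` (the Hodge conjecture with `B• = D•` on every
  `A₀^a × A₁^b` for nondegenerate types with no common coefficient — UNCONDITIONALLY),
  **`forall_prod_hodgeClassSpan_eq_iff_not_exists_commonCoeff`** and **`forall_prod_hodgeClassSpan_eq_iff_forall_rel`**
  (SIMPLE, pairwise NON-ISOGENOUS realisations: `B• = D•` on ALL products IFF …; otherwise an exceptional Hodge class on
  some product).

A finite linear system once `Aut(ℂ)` is replaced by the Galois group of the compositum of the normal closures acting on
`⊔_i Hom(K_i, ℂ)`: the decidable test behind every two-slot cell of the census (reducible base modules included).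

## References

* [Gordon1999HodgeAVSurvey] B. B. Gordon, *A survey of the Hodge conjecture for abelian varieties*, §3 Theorem (Imai,
  Murty) with proof, 7.4–7.7, 10.10.
* [Mai1989] L. Mai, *Lower bounds for the ranks of CM types*, J. Number Theory 32 (1989), §2 Prop. 1 (proof).
* [Serre1977] J.-P. Serre, *Linear Representations of Finite Groups*, GTM 42, §7.2.
-/

set_option autoImplicit false

noncomputable section

open scoped BigOperators

/-! ### §1 CM fields -/

namespace Summit.HodgeConjecture.CorCM

open CategoryTheory CategoryTheory.Limits NumberField Module
open Literature.NumberTheory.ComplexMultiplication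
open Literature.AlgebraicGeometry.Motives (AbelianVariety CMType)
open Literature.AlgebraicGeometry.HodgeTheory
open Literature.AlgebraicGeometry.ComplexMultiplication (IsCMTypeRealisation)
open Literature.AlgebraicGeometry.VanGeemen1994 (hodgeClassSpan)
open Literature.AlgebraicGeometry.Pohlmann1968
open Literature.Barriers.HodgeConjecture (divisorClassesSpan)
open scoped Classical

variable {I : Type} {K : I → Type} [∀ i, Field (K i)] [∀ i, NumberField (K i)] [∀ i, IsCMField (K i)] [Fintype I]
  [DecidableEq I] {Φ : ∀ i, CMType (K i)}

omit [∀ i, IsCMField (K i)] [DecidableEq I] in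
/-- `|⊔_i Hom(K_i, ℂ)| = Σ_i [K_i : ℚ]`. [folklore] -/
private theorem card_sigma_ringHom_eq_sum₅₄' : Fintype.card ((i : I) × (K i →+* ℂ)) = ∑ i, finrank ℚ (K i) := by
  rw [Fintype.card_sigma]
  exact Finset.sum_congr rfl fun i _ => Embeddings.card (K i) ℂ

section Types

/-- **THE HYPOTHESIS-FREE CRITERION FOR ANY FINITE FAMILY OF CM FIELDS (rank form).**  Types `Φ_i` of CM fields `K_i`,
type vectors `u_i = 𝟙_{Φ_i} − 𝟙_{Φ̄_i}` on `Hom(K_i, ℂ)`: `rank(Σ) + |I| = Σ_i rank Φ_i + 1` (`Hg(∏ A_i) = ∏ Hg(A_i)`) IFF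
every relation `Σ_i Σ_x μ_i(x) u_i(g ∘ x) = 0` (all `g ∈ Aut(ℂ)`) has `Σ_x μ_i(x) u_i(g ∘ x) = 0` for each `i` and `g`.
[cite: Gordon1999HodgeAVSurvey, §3 Theorem (1) and 7.7] [cite: Mai1989, §2 Prop. 1 (proof)] -/
theorem cmFamilyRank_add_card_eq_iff_forall_rel [Nonempty I] :
    CMAlgebra.cmFamilyRank Φ + Fintype.card I = (∑ i, cmTypeRank (Φ i)) + 1 ↔
      ∀ μ : ∀ i, (K i →+* ℂ) → ℚ,
        (∀ g : ℂ ≃+* ℂ, ∑ i, ∑ x, μ i x * antiVec (Φ i).1 (1 : ℂ ≃+* ℂ) (g • x) = 0) →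
          ∀ (i : I) (g : ℂ ≃+* ℂ), ∑ x, μ i x * antiVec (Φ i).1 (1 : ℂ ≃+* ℂ) (g • x) = 0 :=
  CommonCoeff.typeRank_sigmaType_add_card_eq_iff_forall_rel (G := ℂ ≃+* ℂ) (Φ := fun i => (Φ i).1)
    fun i => isCMTypeWith_conj (Φ i)

/-- **Nondegeneracy form, any finite family of CM fields**: `(Φ_i)_i` is nondegenerate (`B• = D•` on every product of
realisations) IFF every `Φ_i` is nondegenerate and every matrix-coefficient relation splits slot by slot.
[cite: Gordon1999HodgeAVSurvey, 7.5–7.7] -/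
theorem isNondegenerateFamily_iff_forall_rel [Nonempty I] :
    CMAlgebra.IsNondegenerateFamily Φ ↔ (∀ i, IsNondegenerate (Φ i)) ∧
      ∀ μ : ∀ i, (K i →+* ℂ) → ℚ,
        (∀ g : ℂ ≃+* ℂ, ∑ i, ∑ x, μ i x * antiVec (Φ i).1 (1 : ℂ ≃+* ℂ) (g • x) = 0) →
          ∀ (i : I) (g : ℂ ≃+* ℂ), ∑ x, μ i x * antiVec (Φ i).1 (1 : ℂ ≃+* ℂ) (g • x) = 0 := by
  have key := CommonCoeff.typeRank_sigmaType_eq_iff_forall_rel (G := ℂ ≃+* ℂ) (Φ := fun i => (Φ i).1)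
    fun i => isCMTypeWith_conj (Φ i)
  rw [CMAlgebra.isNondegenerateFamily_iff, ← card_sigma_ringHom_eq_sum₅₄' (K := K)]
  refine key.trans (and_congr_left fun _ => forall_congr' fun i => ?_)
  rw [isNondegenerate_iff, cmTypeRank, ← Embeddings.card (K i) ℂ]

variable {i₀ i₁ : I}

/-- **THE HYPOTHESIS-FREE CRITERION FOR TWO CM FIELDS (rank form).**  `I = {i₀, i₁}`, ANY CM fields `K_{i₀}`, `K_{i₁}`,
ANY types: `rank(Φ₀, Φ₁) + 2 = rank Φ₀ + rank Φ₁ + 1` (`Hg(A₀ × A₁) = Hg(A₀) × Hg(A₁)`) IFF there are NO `μ : Hom(K_{i₀}, ℂ) → ℚ`,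
`λ : Hom(K_{i₁}, ℂ) → ℚ` with `Σ_x μ(x) u₀(g ∘ x) = Σ_y λ(y) u₁(g ∘ y)` for all `g ∈ Aut(ℂ)` and some value non-zero.
[cite: Gordon1999HodgeAVSurvey, §3 Theorem (1) and 7.5–7.7] [cite: Serre1977, §7.2] -/
theorem cmFamilyRank_add_card_eq_iff_not_exists_commonCoeff (hI : ∀ i, i = i₀ ∨ i = i₁) (h01 : i₀ ≠ i₁) :
    CMAlgebra.cmFamilyRank Φ + Fintype.card I = (∑ i, cmTypeRank (Φ i)) + 1 ↔
      ¬ ∃ (μ : (K i₀ →+* ℂ) → ℚ) (lam : (K i₁ →+* ℂ) → ℚ),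
        (∀ g : ℂ ≃+* ℂ, ∑ x, μ x * antiVec (Φ i₀).1 (1 : ℂ ≃+* ℂ) (g • x) =
          ∑ y, lam y * antiVec (Φ i₁).1 (1 : ℂ ≃+* ℂ) (g • y)) ∧
          ∃ g : ℂ ≃+* ℂ, ∑ x, μ x * antiVec (Φ i₀).1 (1 : ℂ ≃+* ℂ) (g • x) ≠ 0 :=
  haveI : Nonempty I := ⟨i₀⟩
  CommonCoeff.typeRank_sigmaType_add_card_eq_iff_not_exists_commonCoeff (G := ℂ ≃+* ℂ) (Φ := fun i => (Φ i).1)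
    (fun i => isCMTypeWith_conj (Φ i)) hI h01

/-- **Nondegeneracy form, two CM fields**: `(Φ₀, Φ₁)` is nondegenerate IFF `Φ₀` and `Φ₁` are nondegenerate and their
type vectors have no common non-zero matrix coefficient. [cite: Gordon1999HodgeAVSurvey, 7.5–7.7] -/
theorem isNondegenerateFamily_iff_not_exists_commonCoeff (hI : ∀ i, i = i₀ ∨ i = i₁) (h01 : i₀ ≠ i₁) :
    CMAlgebra.IsNondegenerateFamily Φ ↔ IsNondegenerate (Φ i₀) ∧ IsNondegenerate (Φ i₁) ∧
      ¬ ∃ (μ : (K i₀ →+* ℂ) → ℚ) (lam : (K i₁ →+* ℂ) → ℚ),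
        (∀ g : ℂ ≃+* ℂ, ∑ x, μ x * antiVec (Φ i₀).1 (1 : ℂ ≃+* ℂ) (g • x) =
          ∑ y, lam y * antiVec (Φ i₁).1 (1 : ℂ ≃+* ℂ) (g • y)) ∧
          ∃ g : ℂ ≃+* ℂ, ∑ x, μ x * antiVec (Φ i₀).1 (1 : ℂ ≃+* ℂ) (g • x) ≠ 0 := by
  haveI : Nonempty I := ⟨i₀⟩
  have key := CommonCoeff.typeRank_sigmaType_eq_iff_not_exists_commonCoeff (G := ℂ ≃+* ℂ) (Φ := fun i => (Φ i).1)
    (fun i => isCMTypeWith_conj (Φ i)) hI h01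
  rw [CMAlgebra.isNondegenerateFamily_iff, ← card_sigma_ringHom_eq_sum₅₄' (K := K), isNondegenerate_iff,
    isNondegenerate_iff, cmTypeRank, cmTypeRank, ← Embeddings.card (K i₀) ℂ, ← Embeddings.card (K i₁) ℂ]
  exact key

/-- **A common non-zero matrix coefficient makes ANY pair degenerate** (no hypothesis on the two CM fields).
[cite: Gordon1999HodgeAVSurvey, §3 Theorem (proof) and 7.5] -/
theorem not_isNondegenerateFamily_of_commonCoeff (hI : ∀ i, i = i₀ ∨ i = i₁) (h01 : i₀ ≠ i₁)
    {μ : (K i₀ →+* ℂ) → ℚ} {lam : (K i₁ →+* ℂ) → ℚ}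
    (hrel : ∀ g : ℂ ≃+* ℂ, ∑ x, μ x * antiVec (Φ i₀).1 (1 : ℂ ≃+* ℂ) (g • x) =
      ∑ y, lam y * antiVec (Φ i₁).1 (1 : ℂ ≃+* ℂ) (g • y))
    {g : ℂ ≃+* ℂ} (hg : ∑ x, μ x * antiVec (Φ i₀).1 (1 : ℂ ≃+* ℂ) (g • x) ≠ 0) :
    ¬ CMAlgebra.IsNondegenerateFamily Φ := fun hnd =>
  ((isNondegenerateFamily_iff_not_exists_commonCoeff hI h01).1 hnd).2.2 ⟨μ, lam, hrel, g, hg⟩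

end Types

/-! ### §2 Abelian varieties -/

section Varieties

variable [Nonempty I] {A : I → AbelianVariety ℂ} {ι : ∀ i, 𝓞 (K i) →+* End (A i)}
  {θ : ∀ i, K i →+* Module.End ℂ (complexBetti (A i).X 1)} {i₀ i₁ : I}

/-- **The Hodge conjecture on every `A₀^a × A₁^b`** (every `⨁_{j<N} A_{π j}`), with `B• = D•` there, for realisations of
NONDEGENERATE types of ANY two CM fields with no common non-zero matrix coefficient — UNCONDITIONALLY.
[cite: Gordon1999HodgeAVSurvey, 7.5 and 10.10] -/
theorem hodgeConjectureFor_prod_of_not_exists_commonCoeff (hI : ∀ i, i = i₀ ∨ i = i₁) (h01 : i₀ ≠ i₁)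
    (hnd₀ : IsNondegenerate (Φ i₀)) (hnd₁ : IsNondegenerate (Φ i₁))
    (hnot : ¬ ∃ (μ : (K i₀ →+* ℂ) → ℚ) (lam : (K i₁ →+* ℂ) → ℚ),
      (∀ g : ℂ ≃+* ℂ, ∑ x, μ x * antiVec (Φ i₀).1 (1 : ℂ ≃+* ℂ) (g • x) =
        ∑ y, lam y * antiVec (Φ i₁).1 (1 : ℂ ≃+* ℂ) (g • y)) ∧
        ∃ g : ℂ ≃+* ℂ, ∑ x, μ x * antiVec (Φ i₀).1 (1 : ℂ ≃+* ℂ) (g • x) ≠ 0)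
    (hA : ∀ i, IsCMTypeRealisation (Φ i) (A i) (ι i) (θ i)) {N : ℕ} (π : Fin N → I) :
    HodgeConjectureFor (⨁ fun j : Fin N => A (π j)).dim (⨁ fun j : Fin N => A (π j)).X ∧
      ∀ m : ℕ, hodgeClassSpan (⨁ fun j : Fin N => A (π j)).dim (⨁ fun j : Fin N => A (π j)).X m =
        divisorClassesSpan (⨁ fun j : Fin N => A (π j)).X (⨁ fun j : Fin N => A (π j)).dim m :=
  have h := (isNondegenerateFamily_iff_not_exists_commonCoeff hI h01).2 ⟨hnd₀, hnd₁, hnot⟩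
  ⟨h.hodgeConjectureFor_prod hA π, fun m => h.hodgeClassSpan_prod_eq_divisorClassesSpan hA π m⟩

/-- **SIMPLE, NON-ISOGENOUS `A₀`, `A₁` with CM by ANY two CM fields: `B• = D•` on ALL products `A₀^a × A₁^b` IFF both
types are nondegenerate and have no common non-zero matrix coefficient**; otherwise some product carries an exceptional
Hodge class. [cite: Gordon1999HodgeAVSurvey, 7.5 and 7.6.1] -/
theorem forall_prod_hodgeClassSpan_eq_iff_not_exists_commonCoeff (hI : ∀ i, i = i₀ ∨ i = i₁) (h01 : i₀ ≠ i₁)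
    (hA : ∀ i, IsCMTypeRealisation (Φ i) (A i) (ι i) (θ i)) (hs : ∀ i, (A i).IsSimple)
    (hniso : ∀ i i', i ≠ i' → ¬ AbelianVariety.IsIsogenous (A i) (A i')) :
    (∀ (N : ℕ) (π : Fin N → I) (m : ℕ),
      hodgeClassSpan (⨁ fun j : Fin N => A (π j)).dim (⨁ fun j : Fin N => A (π j)).X m =
        divisorClassesSpan (⨁ fun j : Fin N => A (π j)).X (⨁ fun j : Fin N => A (π j)).dim m) ↔
      IsNondegenerate (Φ i₀) ∧ IsNondegenerate (Φ i₁) ∧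
        ¬ ∃ (μ : (K i₀ →+* ℂ) → ℚ) (lam : (K i₁ →+* ℂ) → ℚ),
          (∀ g : ℂ ≃+* ℂ, ∑ x, μ x * antiVec (Φ i₀).1 (1 : ℂ ≃+* ℂ) (g • x) =
            ∑ y, lam y * antiVec (Φ i₁).1 (1 : ℂ ≃+* ℂ) (g • y)) ∧
            ∃ g : ℂ ≃+* ℂ, ∑ x, μ x * antiVec (Φ i₀).1 (1 : ℂ ≃+* ℂ) (g • x) ≠ 0 := by
  rw [← CMAlgebra.isNondegenerateFamily_iff_forall_prod_hodgeClassSpan_eq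
    (CMAlgebra.isSeparatingFamily_of_isSimple_of_pairwise_not_isIsogenous hA hs hniso) hA]
  exact isNondegenerateFamily_iff_not_exists_commonCoeff hI h01

/-- **SIMPLE, PAIRWISE NON-ISOGENOUS `A_i` with CM by ANY CM fields, any number of factors: `B• = D•` on ALL products
`∏ A_i^{k_i}` IFF every type is nondegenerate and every matrix-coefficient relation splits slot by slot.**
[cite: Gordon1999HodgeAVSurvey, 7.5 and 7.6.1] -/
theorem forall_prod_hodgeClassSpan_eq_iff_forall_rel
    (hA : ∀ i, IsCMTypeRealisation (Φ i) (A i) (ι i) (θ i)) (hs : ∀ i, (A i).IsSimple)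
    (hniso : ∀ i i', i ≠ i' → ¬ AbelianVariety.IsIsogenous (A i) (A i')) :
    (∀ (N : ℕ) (π : Fin N → I) (m : ℕ),
      hodgeClassSpan (⨁ fun j : Fin N => A (π j)).dim (⨁ fun j : Fin N => A (π j)).X m =
        divisorClassesSpan (⨁ fun j : Fin N => A (π j)).X (⨁ fun j : Fin N => A (π j)).dim m) ↔
      (∀ i, IsNondegenerate (Φ i)) ∧
        ∀ μ : ∀ i, (K i →+* ℂ) → ℚ,
          (∀ g : ℂ ≃+* ℂ, ∑ i, ∑ x, μ i x * antiVec (Φ i).1 (1 : ℂ ≃+* ℂ) (g • x) = 0) →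
            ∀ (i : I) (g : ℂ ≃+* ℂ), ∑ x, μ i x * antiVec (Φ i).1 (1 : ℂ ≃+* ℂ) (g • x) = 0 := by
  rw [← CMAlgebra.isNondegenerateFamily_iff_forall_prod_hodgeClassSpan_eq
    (CMAlgebra.isSeparatingFamily_of_isSimple_of_pairwise_not_isIsogenous hA hs hniso) hA]
  exact isNondegenerateFamily_iff_forall_rel

end Varieties

end Summit.HodgeConjecture.CorCM

end
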